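import Literature.NumberTheory.Automorphic.NewformAdelisationArchCovariance
import HarnessLib

/-!
# The adelic lift of a cusp form is killed by the lowering operator and is a Casimir
# eigenfunction: `X φ_f = 0`, `Ω φ_f = (k² - 2k)/2 · φ_f`, `C φ_f = ((k-1)²/2 - ½) φ_f`

Topic `NumberTheory/Automorphic`; theorems only (no definition, no named fact; D-0026). Second-order
brick of the dictionary `f ↦ π_f` (Gelbart 1975, §3; Gelbart 1997, (2.5.4) (v), Remark 2.5.5;
Bump 1997, §2.1–2.2 and §3.6), continuing `NewformAdelisationArchCovariance` (slices, weight `k`,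
`W φ_f = ik φ_f`, `Z φ_f = 0`). For a cusp form `f ∈ S_k(Γ₁(N))` and its adelic lift
`φ_f = adelicLiftFunA N k f` on `GL₂(𝔸_ℚ)`, assumed smooth in the archimedean variable of the
`GL₂/ℚ` automorphy datum (`hφ`; the smoothness of the lift of a holomorphic form is a separate,
purely analytic brick), along `ι_𝔸 : GL₂(ℝ) → GL₂(𝔸_ℚ)`:

* `exists_archSlice_adelicLiftFun_eq` — **exact slices**: for every `a ∈ GL₂(𝔸_ℚ)` there is
  `h₀ ∈ GL₂(ℝ)⁺` with `φ_f(a (y, 1)) = φ_f((h₀ y, 1))` for ALL `y ∈ GL₂(ℝ)` (left `GL₂(ℚ)`- and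
  right `K₁(N)`-invariance; no determinant condition);
* `lowering_archPart_adelicLiftFun_eq_zero` — **`X · F_φ = 0` on `GL₂(ℝ)⁺`** for the archimedean
  part `F_φ(y) = φ_f((y, 1))`: at the section points `g_τ` by holomorphy of `f = f_{F_φ}`
  (`mdifferentiableAt_archDescent_iff_lowering`), at `g_τ r k_θ` by the weight `k - 2` of `X F_φ`
  (`IsWeightVec.weight_lowerFun`) and the invariance under `ℝ_{>0}`;
* `lowerFun_adelicLiftFunA_eq_zero` — **`X φ_f = 0` along `ι_𝔸` at every adelic point** (slices);
* `casimirFun_adelicLiftFunA` — **`Ω φ_f = ((k² - 2k)/2) φ_f`** (`Ω = ½h² + ef + fe`), from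
  `X̄ X φ = 2Ω φ + W(Wφ) - 2i Wφ` (`GL2Real.raiseFun_lowerFun`), `X φ_f = 0`, `W φ_f = ik φ_f`;
* `sum_lieDeriv_single_adelicLiftFunA` — **`C φ_f = ∑_{a,b} E_{ab}E_{ba} φ_f = ((k-1)²/2 - ½) φ_f`**
  (`C = Ω + ½ Z²`, `GL2Real.casimirFun_add_half_zz`, `Z φ_f = 0`), i.e. the Casimir scalar of the
  Harish-Chandra parameter `{(k-1)/2, (1-k)/2}` of the discrete series `D_k` (Knapp Thm. 5.44;
  Bump 1997, Thm. 2.2.1 ff.) — the hypothesis of `Rat.isZFinite_of_casimir_of_zed` and of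
  `GL2Casimir.hasHCParameter_of_sum_rho_single_of_rho_one`.

## References

* S. Gelbart, *Automorphic forms on adele groups* (1975), §3, Prop. 3.1. [Gelbart1975]
* S. Gelbart, *Three lectures …* (1997), (2.5.4) (v), Remark 2.5.5. [Gelbart1997]
* D. Bump, *Automorphic Forms and Representations* (1997), §2.1 (Exercise 2.1.7), §2.2
  (Prop. 2.2.5), §3.6. [Bump1997]
* A. W. Knapp, *Lie Groups Beyond an Introduction* (2002), Thm. 5.44. [Knapp2002]
-/

noncomputable section

open scoped MatrixGroups Matrix Manifold Classical
open NumberField NumberField.mixedEmbedding UpperHalfPlane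

namespace Literature.NumberTheory.Automorphic

-- Mathlib idiom (Mathlib/Algebra/Lie/OfAssociative.lean), as in `GL2WeightVectors`: Lie subalgebras of matrix algebras.
attribute [local instance 100] LieRing.ofAssociativeRing

open GL2Real

/-! ### Calculus on `GL₂(ℝ)`: left translation, central scalars -/

section Calculus

/-- Lie derivatives (on the right) commute with left translations:
`(M (G(h ·)))(x) = (M G)(h x)`. Borel–Jacquet 1979, §1.5. [folklore] -/
theorem lieDeriv_incl_comp_mul_left (G : GL (Fin 2) ℝ → ℂ) (h x : GL (Fin 2) ℝ)
    (M : Matrix (Fin 2) (Fin 2) ℝ) :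
    lieDeriv incl (toLie M) (fun y => G (h * y)) x = lieDeriv incl (toLie M) G (h * x) := by
  unfold lieDeriv
  congr 1
  funext t
  simp only [mul_assoc]

/-- The lowering operator commutes with left translations. [folklore] -/
theorem lowering_comp_mul_left (G : GL (Fin 2) ℝ → ℂ) (h x : GL (Fin 2) ℝ) :
    lowering (fun y => G (h * y)) x = lowering G (h * x) := by
  simp only [lowering_apply, lieDeriv_incl_comp_mul_left]

/-- The positive real scalars are central in `GL₂(ℝ)`. [folklore] -/
theorem mul_realScalarGL_comm (g : GL (Fin 2) ℝ) {r : ℝ} (hr : 0 < r) :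
    g * realScalarGL r hr = realScalarGL r hr * g := by
  refine Units.ext ?_
  rw [Units.val_mul, Units.val_mul, coe_realScalarGL, Matrix.mul_smul, Matrix.smul_mul,
    Matrix.mul_one, Matrix.one_mul]

/-- Lie derivatives of a function invariant under the positive scalars are invariant under the
positive scalars (`x r exp(tM) = x exp(tM) r`). [folklore] -/
theorem lieDeriv_incl_mul_realScalarGL {G : GL (Fin 2) ℝ → ℂ} {r : ℝ} {hr : 0 < r}
    (hG : ∀ y, G (y * realScalarGL r hr) = G y) (x : GL (Fin 2) ℝ) (M : Matrix (Fin 2) (Fin 2) ℝ) :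
    lieDeriv incl (toLie M) G (x * realScalarGL r hr) = lieDeriv incl (toLie M) G x := by
  unfold lieDeriv
  congr 1
  funext t
  rw [mul_assoc, ← mul_realScalarGL_comm _ hr, ← mul_assoc, hG]

/-- Hence the lowering operator of such a function is invariant under the positive scalars. [folklore] -/
theorem lowering_mul_realScalarGL {G : GL (Fin 2) ℝ → ℂ} {r : ℝ} {hr : 0 < r}
    (hG : ∀ y, G (y * realScalarGL r hr) = G y) (x : GL (Fin 2) ℝ) :
    lowering G (x * realScalarGL r hr) = lowering G x := by
  simp only [lowering_apply, lieDeriv_incl_mul_realScalarGL hG]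

/-- The raising operator of the zero function vanishes. [folklore] -/
theorem raiseFun_zero {G : Type*} [Group G] (ι : (RealMatrixGroup.gl ℝ (Fin 2)).carrier →* G) :
    raiseFun ι (0 : G → ℂ) = 0 := by
  unfold raiseFun
  simp only [lieDeriv_zero_right, add_zero, smul_zero]

end Calculus

/-! ### The archimedean part `F_φ(y) = φ_f((y, 1))` of the lift of a cusp form -/

section CuspFormLift

variable {N : ℕ} [NeZero N] {k : ℤ} (f : CuspForm (CongruenceSubgroup.Gamma1 N) k)
  {hcpt : isCompact_glFiniteIntegralLevel 2 ℚ}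

/-- **Exact archimedean slices of `φ_f`**: for every `a ∈ GL₂(𝔸_ℚ)` there is `h₀ ∈ GL₂(ℝ)⁺` with
`φ_f(a (y, 1)) = φ_f((h₀ y, 1))` for all `y ∈ GL₂(ℝ)`: `a = γ (h₀, 1)(1, h_f)` with `γ ∈ GL₂(ℚ)`,
`h_f ∈ K₁(N)` (`Rat.exists_ofGlobal_inv_mul_mem_plusLevelOne`, `Rat.ofRealGL_archGL_mul_ofFinite_sndHom`),
and `φ_f` is left `GL₂(ℚ)`-invariant and right `K₁(N)`-invariant (`adelicLiftFun_ofGlobal_mul`,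
`adelicLiftFun_mul_ofFinite`; `(1, h_f)` commutes with `(y, 1)`). Gelbart 1975, Prop. 3.1 (i)–(ii).
[cite: Gelbart1975, Prop. 3.1] -/
theorem exists_archSlice_adelicLiftFun_eq (a : GL (Fin 2) (AdeleRing (𝓞 ℚ) ℚ)) :
    ∃ h₀ : GL (Fin 2) ℝ, 0 < h₀.det.val ∧ ∀ y : GL (Fin 2) ℝ,
      adelicLiftFun N k f (a * Rat.ofRealGL 2 y) = adelicLiftFun N k f (Rat.ofRealGL 2 (h₀ * y)) := by
  obtain ⟨γ, hγ⟩ := Rat.exists_ofGlobal_inv_mul_mem_plusLevelOne (Ideal.span {(N : 𝓞 ℚ)}) a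
  obtain ⟨hdet, hfin⟩ := Rat.mem_plusLevelOne_iff.1 hγ
  set h := (GLn.ofGlobal 2 ℚ γ)⁻¹ * a with hh
  refine ⟨Rat.archGL 2 h, hdet, fun y ↦ ?_⟩
  have ha : a = GLn.ofGlobal 2 ℚ γ * h := by rw [hh, mul_inv_cancel_left]
  have hfac : h = Rat.ofRealGL 2 (Rat.archGL 2 h) * GLn.ofFinite 2 ℚ (GLn.sndHom 2 ℚ h) :=
    (Rat.ofRealGL_archGL_mul_ofFinite_sndHom 2 h).symm
  have hcomm : GLn.ofFinite 2 ℚ (GLn.sndHom 2 ℚ h) * Rat.ofRealGL 2 y =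
      Rat.ofRealGL 2 y * GLn.ofFinite 2 ℚ (GLn.sndHom 2 ℚ h) := by
    rw [Rat.ofRealGL_eq_ofInfinite]
    exact ((GLn.commute_ofInfinite_ofFinite (Rat.realToMixedGL 2 y) (GLn.sndHom 2 ℚ h)).eq).symm
  calc adelicLiftFun N k f (a * Rat.ofRealGL 2 y)
      = adelicLiftFun N k f (h * Rat.ofRealGL 2 y) := by
        rw [ha, mul_assoc, adelicLiftFun_ofGlobal_mul]
    _ = adelicLiftFun N k f (Rat.ofRealGL 2 (Rat.archGL 2 h) * Rat.ofRealGL 2 y *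
          GLn.ofFinite 2 ℚ (GLn.sndHom 2 ℚ h)) := by
        conv_lhs => rw [hfac]
        rw [mul_assoc, hcomm, ← mul_assoc]
    _ = adelicLiftFun N k f (Rat.ofRealGL 2 (Rat.archGL 2 h * y)) := by
        rw [adelicLiftFun_mul_ofFinite f hfin, map_mul (Rat.ofRealGL 2)]

/-- The archimedean part `F_φ` is a vector of **weight `k` under `SO(2)`** on all of `GL₂(ℝ)`
(`isWeightVec_adelicLiftFunA` along `y ↦ (y, 1)`). [cite: Gelbart1997, (2.5.4) (iii)] -/
theorem isWeightVec_archPart_adelicLiftFun :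
    IsWeightVec incl k (fun y : GL (Fin 2) ℝ => adelicLiftFun N k f (Rat.ofRealGL 2 y)) := by
  intro θ y
  have h := isWeightVec_adelicLiftFunA (N := N) (k := k) f θ (Rat.ofRealGLA y)
  change adelicLiftFun N k f (Rat.ofRealGL 2 y * Rat.ofRealGL 2 (rotK θ : GL (Fin 2) ℝ)) =
    Complex.exp (k * θ * Complex.I) * adelicLiftFun N k f (Rat.ofRealGL 2 y) at h
  change adelicLiftFun N k f (Rat.ofRealGL 2 (y * (rotK θ : GL (Fin 2) ℝ))) = _
  rw [map_mul]
  exact h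

/-- The archimedean part `F_φ` is **invariant under the positive scalars** on all of `GL₂(ℝ)`
(`adelicLiftFun_mul_ofRealGLA_realScalarGL`). [cite: Gelbart1997, (2.5.4) (iv)] -/
theorem archPart_adelicLiftFun_mul_realScalarGL {r : ℝ} (hr : 0 < r) (y : GL (Fin 2) ℝ) :
    adelicLiftFun N k f (Rat.ofRealGL 2 (y * realScalarGL r hr)) = adelicLiftFun N k f (Rat.ofRealGL 2 y) := by
  rw [map_mul]
  exact adelicLiftFun_mul_ofRealGLA_realScalarGL f _ hr

/-- **`X · F_φ = 0` on `GL₂(ℝ)⁺`** (Gelbart 1997, (2.5.4) (v); Bump 1997, Exercise 2.1.7 (a)): the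
archimedean part of the lift of a holomorphic cusp form is killed by the lowering operator at
every `g` of positive determinant. At the section points `g_τ`: `f_{F_φ} = f` is holomorphic
(`archDescent_adelicLiftFun`, `mdifferentiableAt_archDescent_iff_lowering` with
`hasArchWeight_adelicLiftFun`). In general `g = g_τ r r(θ)` (`τ = g i`; the stabiliser of `i` in
`GL₂(ℝ)⁺` is `ℝ_{>0} SO(2)`, `exists_eq_realScalarGL_mul_rotGL`), and `X F_φ` has weight `k - 2`
(`IsWeightVec.weight_lowerFun`) and is invariant under `ℝ_{>0}` (`lowering_mul_realScalarGL`).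
[cite: Gelbart1997, (2.5.4) (v)] [cite: Bump1997, Exercise 2.1.7] -/
theorem lowering_archPart_adelicLiftFun_eq_zero
    (hφ : IsArchSmooth (AutomorphyDatum.gl 2 ℚ hcpt).ofArch (adelicLiftFunA N k f))
    {g : GL (Fin 2) ℝ} (hg : 0 < g.det.val) :
    lowering (fun y : GL (Fin 2) ℝ => adelicLiftFun N k f (Rat.ofRealGL 2 y)) g = 0 := by
  set Fφ : GL (Fin 2) ℝ → ℂ := fun y => adelicLiftFun N k f (Rat.ofRealGL 2 y) with hFφ
  -- smoothness of the archimedean part: the `n = 2` instance of `IsArchSmooth.comp_ofRealGL`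
  -- (NewformAdelisationArchTransport; dedup-02608)
  have hs : IsArchSmooth incl Fφ := hφ.comp_ofRealGL
  have hw : IsWeightVec incl k Fφ := isWeightVec_archPart_adelicLiftFun f
  have hW : HasArchWeight k Fφ := hasArchWeight_adelicLiftFun f
  -- at the section points
  have hsec : ∀ τ : ℍ, lowering Fφ (upperHalfPlaneToGL τ) = 0 := by
    intro τ
    refine (mdifferentiableAt_archDescent_iff_lowering hs hW τ).mp ?_
    rw [hFφ, archDescent_adelicLiftFun f]
    exact CuspFormClass.holo f τ
  -- `g = g_τ κ`, `κ = r r(θ)`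
  set τ : ℍ := g • UpperHalfPlane.I with hτ
  set κ : GL (Fin 2) ℝ := (upperHalfPlaneToGL τ)⁻¹ * g with hκdef
  have e : g = upperHalfPlaneToGL τ * κ := by rw [hκdef, mul_inv_cancel_left]
  have hdet : g.det.val = τ.im * κ.det.val := by
    conv_lhs => rw [e, map_mul, Units.val_mul, det_upperHalfPlaneToGL]
  have hκ : 0 < κ.det.val := by
    have h : 0 < τ.im * κ.det.val := hdet ▸ hg
    exact pos_of_mul_pos_right h τ.im_pos.le
  have hκI : κ • UpperHalfPlane.I = UpperHalfPlane.I := by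
    have h1 : upperHalfPlaneToGL τ • κ • UpperHalfPlane.I = upperHalfPlaneToGL τ • UpperHalfPlane.I := by
      rw [← mul_smul, ← e, upperHalfPlaneToGL_smul_I]
    exact smul_left_cancel _ h1
  obtain ⟨r, hr, θ, hκeq⟩ := exists_eq_realScalarGL_mul_rotGL hκ hκI
  -- weight `k - 2` of `X F_φ` and invariance under `ℝ_{>0}`
  have hwl : IsWeightVec incl (k - 2) (lowerFun incl Fφ) := hw.weight_lowerFun hs
  have hinv : ∀ y, Fφ (y * realScalarGL r hr) = Fφ y := fun y ↦
    archPart_adelicLiftFun_mul_realScalarGL f hr y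
  -- `g = (g_τ r) k_{-θ}`
  have hg' : g = upperHalfPlaneToGL τ * realScalarGL r hr * incl (rotK (-θ)) := by
    rw [e, hκeq, ← mul_assoc]
    congr 1
    change rotGL θ = ((rotK (-θ) : (RealMatrixGroup.gl ℝ (Fin 2)).carrier) : GL (Fin 2) ℝ)
    rw [coe_rotK, neg_neg]
  have hψ : ∀ y, lowering Fφ y = lowerFun incl Fφ y := fun y ↦ rfl
  have h1 : lowering Fφ (upperHalfPlaneToGL τ * realScalarGL r hr) = 0 := by
    rw [lowering_mul_realScalarGL hinv, hsec τ]
  have h2 := hwl (-θ) (upperHalfPlaneToGL τ * realScalarGL r hr)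
  rw [hψ, hg', h2, ← hψ, h1, mul_zero]

/-- **`X φ_f = 0` along `ι_𝔸` at every point of `GL₂(𝔸_ℚ)`**: the lowering operator
`X = h - i(e + f)` of `𝔤𝔩₂(ℝ)_ℂ`, acting through Lie derivatives along `ι_𝔸`, kills the adelic
lift of a holomorphic cusp form (Gelbart 1997, (2.5.4) (v) "`X · φ = 0`"). Proof: on the exact
slice through `a`, `(X φ_f)(a) = (X · F_φ(h₀ ·))(1) = (X · F_φ)(h₀) = 0`
(`lowering_archPart_adelicLiftFun_eq_zero`). [cite: Gelbart1997, (2.5.4) (v)] -/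
theorem lowerFun_adelicLiftFunA_eq_zero
    (hφ : IsArchSmooth (AutomorphyDatum.gl 2 ℚ hcpt).ofArch (adelicLiftFunA N k f)) :
    lowerFun Rat.iotaA (adelicLiftFunA N k f) = 0 := by
  funext a
  obtain ⟨h₀, hh₀, hslice⟩ := exists_archSlice_adelicLiftFun_eq f (show GL (Fin 2) (AdeleRing (𝓞 ℚ) ℚ) from a)
  have h := lowerFun_inclOf_apply (j := Rat.ofRealGLA) (adelicLiftFunA N k f) a 1
  rw [map_one, mul_one] at h
  rw [h, Pi.zero_apply]
  have e : (fun y : GL (Fin 2) ℝ => adelicLiftFunA N k f (a * Rat.ofRealGLA y)) =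
      fun y : GL (Fin 2) ℝ => adelicLiftFun N k f (Rat.ofRealGL 2 (h₀ * y)) := by
    funext y
    exact hslice y
  rw [e, lowering_comp_mul_left (fun y : GL (Fin 2) ℝ => adelicLiftFun N k f (Rat.ofRealGL 2 y)) h₀ 1,
    mul_one]
  exact lowering_archPart_adelicLiftFun_eq_zero f hφ hh₀

/-- **`Ω φ_f = ((k² - 2k)/2) φ_f` along `ι_𝔸`** for the Casimir operator `Ω = ½h² + ef + fe` of
`𝔰𝔩₂` (`GL2Real.casimirFun`): from `X̄(X φ) = 2Ω φ + W(W φ) - 2i W φ`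
(`GL2Real.raiseFun_lowerFun`) with `X φ_f = 0` and `W φ_f = ik φ_f`. This is the Laplace/Casimir
eigenvalue `k/2 (k/2 - 1)` of weight-`k` holomorphic forms (Bump 1997, §2.1, Exercise 2.1.7 (b),
Prop. 2.2.5; Gelbart 1997, Remark 2.5.5). [cite: Bump1997, Prop. 2.2.5 and Exercise 2.1.7] [cite: Gelbart1997, Remark 2.5.5] -/
theorem casimirFun_adelicLiftFunA
    (hφ : IsArchSmooth (AutomorphyDatum.gl 2 ℚ hcpt).ofArch (adelicLiftFunA N k f)) :
    casimirFun Rat.iotaA (adelicLiftFunA N k f) = ((((k : ℤ) : ℂ) ^ 2 - 2 * k) / 2) • adelicLiftFunA N k f := by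
  have hA : IsArchSmooth Rat.iotaA (adelicLiftFunA N k f) := IsArchSmooth.iotaA hφ
  have h := raiseFun_lowerFun hA
  have hW := lieDeriv_rotGen_adelicLiftFunA (N := N) (k := k) f
  rw [lowerFun_adelicLiftFunA_eq_zero f hφ, raiseFun_zero, hW, lieDeriv_smul, hW, smul_smul] at h
  funext x
  have hx := congrFun h x
  simp only [Pi.add_apply, Pi.sub_apply, Pi.smul_apply, Pi.zero_apply, smul_eq_mul] at hx
  simp only [Pi.smul_apply, smul_eq_mul]
  linear_combination (-(1 / 2 : ℂ)) * hx +
    ((k : ℂ) * adelicLiftFunA N k f x - (k : ℂ) ^ 2 * adelicLiftFunA N k f x / 2) * Complex.I_sq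

/-- **`C φ_f = ∑_{a,b} E_{ab}(E_{ba} φ_f) = ((k-1)²/2 - ½ + 0) φ_f` along `ι_𝔸`**: the Casimir
element `C = Ω + ½Z²` of `𝔤𝔩₂` (`GL2Real.casimirFun_add_half_zz`) acts on the adelic lift of a
weight-`k` cusp form by `s₁² + s₂² - ½` with `{s₁, s₂} = {(k-1)/2, (1-k)/2}`, the Harish-Chandra
parameter of the discrete series `D_k` (Knapp 2002, Thm. 5.44; `Z φ_f = 0`,
`Ω φ_f = (k² - 2k)/2 φ_f`). Stated in the exact shape consumed by
`Rat.isZFinite_of_casimir_of_zed` / `GL2Casimir.hasHCParameter_of_sum_rho_single_of_rho_one`.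
[cite: Knapp2002, Thm. 5.44] [cite: Bump1997, §2.2] -/
theorem sum_lieDeriv_single_adelicLiftFunA
    (hφ : IsArchSmooth (AutomorphyDatum.gl 2 ℚ hcpt).ofArch (adelicLiftFunA N k f)) :
    (∑ a : Fin 2, ∑ b : Fin 2, lieDeriv Rat.iotaA (toLie (Matrix.single a b (1 : ℝ)))
        (lieDeriv Rat.iotaA (toLie (Matrix.single b a (1 : ℝ))) (adelicLiftFunA N k f))) =
      (((((k : ℤ) : ℂ) - 1) / 2) ^ 2 + ((1 - ((k : ℤ) : ℂ)) / 2) ^ 2 - 1 / 2) • adelicLiftFunA N k f := by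
  have hA : IsArchSmooth Rat.iotaA (adelicLiftFunA N k f) := IsArchSmooth.iotaA hφ
  have h := casimirFun_add_half_zz hA
  rw [lieDeriv_one_adelicLiftFunA, lieDeriv_zero_right, smul_zero, add_zero,
    casimirFun_adelicLiftFunA f hφ] at h
  rw [← h]
  congr 1
  ring

end CuspFormLift

end Literature.NumberTheory.Automorphic
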